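import Literature.NumberTheory.LFunctions.SelbergDelangeRieszExpansion
import HarnessLib

/-!
# Crux `SystemZeroRepulsion` (stmt-Parity-11291), line `smooth-rough-lattice-acquisition`
(skeleton v3, lead c2): stub `stub_apHolRieszBound`, part 1 of 2 — the contour at fixed parameters

Class `linₐ` of the crux (`k = 1`, `f = aX + b`, `a ≥ 2`): for a non-principal character the
Dirichlet series `F(s) = Σ a(n) n^{-s}` is HOLOMORPHIC (no pole, no branch point) on a classical
region `zfr c = {σ > 1 − c/log(|t|+4)}` with `‖F(s)‖ ≤ B (K log(|t|+4))^R`.  This file (the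
registered helper `stub_apHolRieszBoundCore`) is Landau's contour argument at FIXED admissible
parameters `σ₀ > 1`, `T > 0`, `σ₁ ∈ [1/2, σ₀]` with `σ₁ ≥ 1 − c'/log(T+4)`, `0 ≤ c' < c`: Perron's
formula of order one for the Riesz mean `A₁(x) = Σ_{n ≤ x} a(n)(x − n)` on `Re s = σ₀`
(`RieszMean.sum_mul_sub_eq_integral_LSeries`), Cauchy's theorem on the rectangle
`[σ₁, σ₀] × [−T, T] ⊂ zfr c` (the proof of `ClassicalPsiData.integral_line_eq`, which uses only the
holomorphy of `F` — there is no pole here), and the bounds for the five pieces: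
`‖A₁(x)‖ ≤ (1/2π)·(2·x^{1+σ₀} S/T + 4π x^{1+σ₁} B (K log(T+4))^R + 2(σ₀−σ₁) x^{1+σ₀} B (K log(T+4))^R/T²)`,
`S = Σ ‖a(n)‖ n^{−σ₀}`.  Part 2 chooses the parameters.  Everything here is PROVED.

## References

* [MontgomeryVaughan2007] H. L. Montgomery, R. C. Vaughan, *Multiplicative Number Theory I*,
  CUP 2007, §7.4, proof of Theorem 7.17 (pp. 177–178); §6.2 Theorem 6.9.
* [LandauMathAnn1903] E. Landau, *Neuer Beweis des Primzahlsatzes und Beweis des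
  Primidealsatzes*, Math. Ann. 56 (1903), 645–670, §§5–7.
-/

noncomputable section

open Complex Set MeasureTheory Filter Topology intervalIntegral
open scoped Real Interval
open Literature.NumberTheory.LFunctions
open Literature.NumberTheory.LFunctions.ClassicalPsiData (zfr mem_zfr isOpen_zfr
  mem_zfr_of_one_le_re mem_zfr_of_rect kernel Phi norm_Phi_eq norm_kernel_le_inv_sq
  norm_kernel_le_four_div differentiableAt_Phi integrable_cpow_mul_LSeries_mul_kernel
  norm_add_add_add_sub_le)

namespace Summit.Parity.BatemanHorn.Cruxes.SystemZeroRepulsion.NearFar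

/-! ### Cauchy's theorem on the rectangle (pole-free) -/

/-- **Cauchy's theorem on the rectangle `[σ₁, σ₀] × [−T, T]`** inside `zfr c` for `F` holomorphic
there: the line integral of `Φ_x(s) = x^{1+s} F(s)/(s(s+1))` over `Re s = σ₀` equals the two tails
`|t| ≥ T`, plus the left side `Re s = σ₁`, plus `i` times (bottom minus top).  (The proof of
`ClassicalPsiData.integral_line_eq`, which uses only the holomorphy of `F`.)
[cite: LandauMathAnn1903, §6] -/
theorem apHol_integral_line_eq {F : ℂ → ℂ} {c : ℝ} (hFd : DifferentiableOn ℂ F (zfr c))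
    {x : ℝ} (hx : 0 < x) {σ₀ σ₁ T c' : ℝ} (hc' : 0 ≤ c') (hc'c : c' < c) (hT : 0 < T)
    (hσ₁ : 0 < σ₁) (hσ₁₀ : σ₁ ≤ σ₀) (hσ₁c : 1 - c' / Real.log (T + 4) ≤ σ₁)
    (hint : Integrable fun t : ℝ ↦ Phi F x (σ₀ + t * I)) :
    ∫ t : ℝ, Phi F x (σ₀ + t * I) =
      (∫ t in Iic (-T), Phi F x (σ₀ + t * I)) + (∫ t in Ioi T, Phi F x (σ₀ + t * I)) +
      (∫ t in (-T)..T, Phi F x (σ₁ + t * I)) +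
      I * (∫ u in σ₁..σ₀, Phi F x (u + (-T) * I)) - I * (∫ u in σ₁..σ₀, Phi F x (u + T * I)) := by
  have hsplit1 := integral_Iic_add_Ioi (b := -T) hint.integrableOn hint.integrableOn
  have hsplit2 := integral_interval_add_Ioi (a := -T) (b := T) hint.integrableOn hint.integrableOn
  -- Cauchy–Goursat on the rectangle
  have hdiff : DifferentiableOn ℂ (Phi F x) (uIcc σ₁ σ₀ ×ℂ uIcc (-T) T) := by
    intro s hs
    rw [uIcc_of_le hσ₁₀, uIcc_of_le (by linarith : -T ≤ T)] at hs
    obtain ⟨⟨hre1, -⟩, him1, him2⟩ := hs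
    have hsz : s ∈ zfr c := mem_zfr_of_rect hc' hc'c (hσ₁c.trans hre1) (abs_le.2 ⟨him1, him2⟩)
    exact (differentiableAt_Phi hx (hFd.differentiableAt
      ((isOpen_zfr c).mem_nhds hsz)) (hσ₁.trans_le hre1)).differentiableWithinAt
  have H := Complex.integral_boundary_rect_eq_zero_of_differentiableOn (Phi F x) ⟨σ₁, -T⟩ ⟨σ₀, T⟩
    hdiff
  dsimp only at H
  simp only [smul_eq_mul, ofReal_neg, neg_mul] at H ⊢
  have key : (∫ y : ℝ in (-T)..T, Phi F x (σ₀ + y * I)) =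
      (∫ y : ℝ in (-T)..T, Phi F x (σ₁ + y * I)) +
        I * (∫ u : ℝ in σ₁..σ₀, Phi F x (u + -(T * I))) -
        I * (∫ u : ℝ in σ₁..σ₀, Phi F x (u + T * I)) := by
    have hI : I * I = -1 := I_mul_I
    linear_combination (-I) * H +
      ((∫ y : ℝ in (-T)..T, Phi F x (σ₀ + y * I)) -
        (∫ y : ℝ in (-T)..T, Phi F x (σ₁ + y * I))) * hI
  rw [← hsplit1, ← hsplit2, key]
  ring

/-! ### Bounds for the five pieces -/

/-- `‖F(s)‖ ≤ B (K log(T + 4))^R` for `s ∈ zfr c` with `|Im s| ≤ T` (`K ≥ 1`, `R ≥ 0`). [folklore] -/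
theorem apHol_norm_F_le {F : ℂ → ℂ} {c K R B : ℝ} (hK : 1 ≤ K) (hR : 0 ≤ R)
    (hFb : ∀ s ∈ zfr c, ‖F s‖ ≤ B * (K * Real.log (|s.im| + 4)) ^ R) (hB : 0 ≤ B)
    {s : ℂ} (hs : s ∈ zfr c) {T : ℝ} (hT : |s.im| ≤ T) :
    ‖F s‖ ≤ B * (K * Real.log (T + 4)) ^ R := by
  refine (hFb s hs).trans (mul_le_mul_of_nonneg_left ?_ hB)
  have h0 : 0 ≤ Real.log (|s.im| + 4) := Real.log_nonneg (by linarith [abs_nonneg s.im])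
  refine Real.rpow_le_rpow (by positivity) ?_ hR
  exact mul_le_mul_of_nonneg_left (Real.log_le_log (by positivity) (by linarith)) (by linarith)

/-- **On the line `Re s = σ₀ > 1`**: `‖Φ_x(σ₀ + it)‖ ≤ x^{1+σ₀} S / t²`, `S = Σ ‖a(n)‖ n^{−σ₀}`,
`t ≠ 0` (`L(a, s) = F(s)` there). [folklore] -/
theorem apHol_norm_Phi_line_le {F : ℂ → ℂ} {a : ℕ → ℂ} {x : ℝ} (hx : 0 < x) {σ₀ : ℝ}
    (hσ₀ : 1 < σ₀) (hsum : LSeriesSummable a σ₀) (hLF : ∀ s : ℂ, 1 < s.re → LSeries a s = F s)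
    {t : ℝ} (ht : t ≠ 0) :
    ‖Phi F x (σ₀ + t * I)‖ ≤
      x ^ (1 + σ₀) * (∑' n : ℕ, ‖LSeries.term a (σ₀ : ℂ) n‖) / t ^ 2 := by
  rw [norm_Phi_eq F hx]
  have hre : ((σ₀ : ℂ) + t * I).re = σ₀ := by simp
  rw [hre, ← hLF _ (by rw [hre]; exact hσ₀)]
  have hL := SelbergDelange.norm_LSeries_le_tsum a (s := (σ₀ : ℂ) + t * I) (by simpa using hsum)
  have hL' : ‖LSeries a (σ₀ + t * I)‖ ≤ ∑' n : ℕ, ‖LSeries.term a (σ₀ : ℂ) n‖ := by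
    simpa using hL
  have hK : ‖kernel ((σ₀ : ℂ) + t * I)‖ ≤ 1 / t ^ 2 := by
    have := norm_kernel_le_inv_sq (s := (σ₀ : ℂ) + t * I) (by simpa using ht)
    simpa using this
  have h0 : 0 ≤ ∑' n : ℕ, ‖LSeries.term a (σ₀ : ℂ) n‖ := tsum_nonneg fun n ↦ norm_nonneg _
  calc x ^ (1 + σ₀) * ‖LSeries a (σ₀ + t * I)‖ * ‖kernel ((σ₀ : ℂ) + t * I)‖
      ≤ x ^ (1 + σ₀) * (∑' n : ℕ, ‖LSeries.term a (σ₀ : ℂ) n‖) * (1 / t ^ 2) :=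
        mul_le_mul (mul_le_mul_of_nonneg_left hL' (by positivity)) hK (norm_nonneg _)
          (by positivity)
    _ = _ := by ring

/-- **The two tails**: `‖∫_{|t| ≥ T} Φ_x(σ₀ + it)‖ ≤ x^{1+σ₀} S / T` each (`T > 0`).
[cite: MontgomeryVaughan2007, §7.4 p. 177] -/
theorem apHol_norm_integral_tails_le {F : ℂ → ℂ} {a : ℕ → ℂ} {x : ℝ} (hx : 0 < x) {σ₀ : ℝ}
    (hσ₀ : 1 < σ₀) (hsum : LSeriesSummable a σ₀) (hLF : ∀ s : ℂ, 1 < s.re → LSeries a s = F s)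
    {T : ℝ} (hT : 0 < T) :
    ‖∫ t in Ioi T, Phi F x (σ₀ + t * I)‖ ≤
        x ^ (1 + σ₀) * (∑' n : ℕ, ‖LSeries.term a (σ₀ : ℂ) n‖) / T ∧
      ‖∫ t in Iic (-T), Phi F x (σ₀ + t * I)‖ ≤
        x ^ (1 + σ₀) * (∑' n : ℕ, ‖LSeries.term a (σ₀ : ℂ) n‖) / T := by
  set S : ℝ := ∑' n : ℕ, ‖LSeries.term a (σ₀ : ℂ) n‖ with hS
  set g : ℝ → ℝ := fun t ↦ x ^ (1 + σ₀) * S * t ^ (-(2 : ℝ)) with hg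
  have hgi : IntegrableOn g (Ioi T) :=
    (integrableOn_Ioi_rpow_of_lt (by norm_num : (-(2 : ℝ)) < -1) hT).const_mul _
  have hval : ∫ t in Ioi T, g t = x ^ (1 + σ₀) * S / T := by
    rw [hg, MeasureTheory.integral_const_mul, integral_Ioi_rpow_of_lt (by norm_num) hT]
    have : (-(2 : ℝ)) + 1 = -1 := by norm_num
    rw [this, Real.rpow_neg_one]
    field_simp
  have hpt : ∀ t : ℝ, T < |t| → ‖Phi F x (σ₀ + t * I)‖ ≤ g |t| := by
    intro t ht
    have ht0 : t ≠ 0 := fun h0 ↦ by rw [h0, abs_zero] at ht; linarith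
    have := apHol_norm_Phi_line_le hx hσ₀ hsum hLF ht0
    rw [hg]
    simp only
    rwa [Real.rpow_neg (abs_nonneg t), Real.rpow_two, sq_abs, ← div_eq_mul_inv]
  constructor
  · have hbound : ∀ᵐ t : ℝ ∂(volume.restrict (Ioi T)), ‖Phi F x (σ₀ + t * I)‖ ≤ g t := by
      refine (ae_restrict_iff' measurableSet_Ioi).2 (Eventually.of_forall fun t (ht : T < t) ↦ ?_)
      have := hpt t (by rwa [abs_of_pos (hT.trans ht)])
      rwa [abs_of_pos (hT.trans ht)] at this
    exact (norm_integral_le_of_norm_le hgi hbound).trans (le_of_eq hval)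
  · rw [← integral_comp_neg_Ioi]
    have hbound : ∀ᵐ t : ℝ ∂(volume.restrict (Ioi T)),
        ‖Phi F x (σ₀ + ((-t : ℝ) : ℂ) * I)‖ ≤ g t := by
      refine (ae_restrict_iff' measurableSet_Ioi).2 (Eventually.of_forall fun t (ht : T < t) ↦ ?_)
      have := hpt (-t) (by rwa [abs_neg, abs_of_pos (hT.trans ht)])
      rwa [abs_neg, abs_of_pos (hT.trans ht)] at this
    exact (norm_integral_le_of_norm_le hgi hbound).trans (le_of_eq hval)

/-- **The horizontal sides** `[σ₁, σ₀] × {±T}`: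
`‖∫_{σ₁}^{σ₀} Φ_x(u ± iT) du‖ ≤ (σ₀ − σ₁) · x^{1+σ₀} B (K log(T+4))^R / T²` (`x ≥ 1`).
[cite: MontgomeryVaughan2007, §7.4 p. 178] -/
theorem apHol_norm_integral_horizontal_le {F : ℂ → ℂ} {c K R B : ℝ} (hK : 1 ≤ K) (hR : 0 ≤ R)
    (hB : 0 ≤ B) (hFb : ∀ s ∈ zfr c, ‖F s‖ ≤ B * (K * Real.log (|s.im| + 4)) ^ R)
    {x : ℝ} (hx : 1 ≤ x) {σ₀ σ₁ T c' : ℝ} (hc' : 0 ≤ c') (hc'c : c' < c) (hT : 0 < T)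
    (hσ₁₀ : σ₁ ≤ σ₀) (hσ₁c : 1 - c' / Real.log (T + 4) ≤ σ₁) {T' : ℝ} (hT' : |T'| = T) :
    ‖∫ u in σ₁..σ₀, Phi F x (u + T' * I)‖ ≤
      (σ₀ - σ₁) * (x ^ (1 + σ₀) * (B * (K * Real.log (T + 4)) ^ R) / T ^ 2) := by
  have hx0 : 0 < x := by linarith
  have hT'0 : T' ≠ 0 := by rintro rfl; simp at hT'; linarith
  have hM0 : 0 ≤ B * (K * Real.log (T + 4)) ^ R := by
    have : 0 ≤ Real.log (T + 4) := Real.log_nonneg (by linarith)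
    positivity
  have hb : ∀ u ∈ Ι σ₁ σ₀, ‖Phi F x (u + T' * I)‖ ≤
      x ^ (1 + σ₀) * (B * (K * Real.log (T + 4)) ^ R) / T ^ 2 := by
    intro u hu
    rw [uIoc_of_le hσ₁₀] at hu
    have him : ((u : ℂ) + T' * I).im = T' := by simp
    have hre : ((u : ℂ) + T' * I).re = u := by simp
    have hmem : ((u : ℂ) + T' * I) ∈ zfr c :=
      mem_zfr_of_rect hc' hc'c (by rw [hre]; linarith [hu.1]) (by rw [him, hT'])
    have hF : ‖F (u + T' * I)‖ ≤ B * (K * Real.log (T + 4)) ^ R :=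
      apHol_norm_F_le hK hR hFb hB hmem (by rw [him, hT'])
    have hKer : ‖kernel (u + T' * I)‖ ≤ 1 / T ^ 2 := by
      have := norm_kernel_le_inv_sq (s := u + T' * I) (by rw [him]; exact hT'0)
      rwa [him, ← sq_abs, hT'] at this
    have hxu : x ^ (1 + u) ≤ x ^ (1 + σ₀) :=
      Real.rpow_le_rpow_of_exponent_le hx (by linarith [hu.2])
    rw [norm_Phi_eq F hx0, hre]
    calc x ^ (1 + u) * ‖F (u + T' * I)‖ * ‖kernel (u + T' * I)‖
        ≤ x ^ (1 + σ₀) * (B * (K * Real.log (T + 4)) ^ R) * (1 / T ^ 2) := by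
          gcongr
      _ = x ^ (1 + σ₀) * (B * (K * Real.log (T + 4)) ^ R) / T ^ 2 := by ring
  have := intervalIntegral.norm_integral_le_of_norm_le_const hb
  rw [abs_of_nonneg (sub_nonneg.2 hσ₁₀)] at this
  linarith [this]

/-- **The left side** `Re s = σ₁` of the rectangle (`σ₁ ≥ 1/2`):
`‖∫_{−T}^{T} Φ_x(σ₁ + it) dt‖ ≤ 4π x^{1+σ₁} B (K log(T+4))^R` (using `∫ dt/(1+t²) = π`).
[cite: MontgomeryVaughan2007, §7.4 p. 178] -/
theorem apHol_norm_integral_left_le {F : ℂ → ℂ} {c K R B : ℝ} (hK : 1 ≤ K) (hR : 0 ≤ R)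
    (hB : 0 ≤ B) (hFb : ∀ s ∈ zfr c, ‖F s‖ ≤ B * (K * Real.log (|s.im| + 4)) ^ R)
    {x : ℝ} (hx : 1 ≤ x) {σ₁ T c' : ℝ} (hc' : 0 ≤ c') (hc'c : c' < c) (hT : 0 < T)
    (hσ₁ : 1 / 2 ≤ σ₁) (hσ₁c : 1 - c' / Real.log (T + 4) ≤ σ₁) :
    ‖∫ t in (-T)..T, Phi F x (σ₁ + t * I)‖ ≤
      4 * π * (x ^ (1 + σ₁) * (B * (K * Real.log (T + 4)) ^ R)) := by
  have hx0 : 0 < x := by linarith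
  have hlog : 0 ≤ Real.log (T + 4) := Real.log_nonneg (by linarith)
  set M : ℝ := 4 * (x ^ (1 + σ₁) * (B * (K * Real.log (T + 4)) ^ R)) with hM
  have hM0 : 0 ≤ M := by positivity
  set g : ℝ → ℝ := fun t ↦ M * (1 + t ^ 2)⁻¹ with hg
  have hgi : Integrable g := integrable_inv_one_add_sq.const_mul M
  have hb : ∀ᵐ t : ℝ, t ∈ Ioc (-T) T → ‖Phi F x (σ₁ + t * I)‖ ≤ g t := by
    refine Eventually.of_forall fun t ht ↦ ?_
    have him : ((σ₁ : ℂ) + t * I).im = t := by simp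
    have hre : ((σ₁ : ℂ) + t * I).re = σ₁ := by simp
    have htT : |t| ≤ T := abs_le.2 ⟨ht.1.le, ht.2⟩
    have hmem : ((σ₁ : ℂ) + t * I) ∈ zfr c :=
      mem_zfr_of_rect hc' hc'c (by rw [hre]; exact hσ₁c) (by rw [him]; exact htT)
    have hF : ‖F (σ₁ + t * I)‖ ≤ B * (K * Real.log (T + 4)) ^ R :=
      apHol_norm_F_le hK hR hFb hB hmem (by rw [him]; exact htT)
    have hKer := norm_kernel_le_four_div hσ₁ t
    rw [norm_Phi_eq F hx0, hre, hg]
    calc x ^ (1 + σ₁) * ‖F (σ₁ + t * I)‖ * ‖kernel (σ₁ + t * I)‖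
        ≤ x ^ (1 + σ₁) * (B * (K * Real.log (T + 4)) ^ R) * (4 * (1 + t ^ 2)⁻¹) := by
          gcongr
      _ = M * (1 + t ^ 2)⁻¹ := by rw [hM]; ring
  have h1 := intervalIntegral.norm_integral_le_of_norm_le (by linarith : -T ≤ T) hb
    (hgi.intervalIntegrable)
  refine h1.trans ?_
  rw [intervalIntegral.integral_of_le (by linarith : -T ≤ T)]
  calc ∫ t in Ioc (-T) T, g t ≤ ∫ t, g t :=
        setIntegral_le_integral hgi (Eventually.of_forall fun t ↦ by simp only [hg]; positivity)
    _ = M * π := by rw [hg, MeasureTheory.integral_const_mul, integral_univ_inv_one_add_sq]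
    _ = 4 * π * (x ^ (1 + σ₁) * (B * (K * Real.log (T + 4)) ^ R)) := by rw [hM]; ring

/-! ### The estimate at fixed parameters -/

/-- **Registered helper `stub_apHolRieszBoundCore` (part 1 of stub D `stub_apHolRieszBound`):
Landau's contour argument at fixed admissible parameters.**  For `F` holomorphic on `zfr c` with
`‖F(s)‖ ≤ B (K log(|t|+4))^R` there (`K ≥ 1`, `R, B ≥ 0`), `Σ a(n) n^{-s} = F(s)` on `σ > 1` with
`Σ |a(n)| n^{-σ₀} < ∞`, and parameters `x ≥ 1`, `σ₀ > 1`, `0 ≤ c' < c`, `T > 0`,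
`1/2 ≤ σ₁ ≤ σ₀`, `σ₁ ≥ 1 − c'/log(T+4)`:
`‖Σ_{n ≤ x} a(n)(x − n)‖ ≤ (1/2π)(2 x^{1+σ₀} S/T + 4π x^{1+σ₁} B (K log(T+4))^R
  + 2 (σ₀ − σ₁) x^{1+σ₀} B (K log(T+4))^R / T²)`, `S = Σ ‖a(n)‖ n^{−σ₀}`
(Perron of order one, Cauchy on `[σ₁, σ₀] × [−T, T]`, and the five piece bounds).
[cite: MontgomeryVaughan2007, §7.4 pp. 177–178] -/
theorem stub_apHolRieszBoundCore :
    ∀ (c K R B : ℝ) (a : ℕ → ℂ) (F : ℂ → ℂ) (x σ₀ σ₁ T c' : ℝ), 1 ≤ K → 0 ≤ R → 0 ≤ B →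
      DifferentiableOn ℂ F (Literature.NumberTheory.LFunctions.ClassicalPsiData.zfr c) →
      (∀ s ∈ Literature.NumberTheory.LFunctions.ClassicalPsiData.zfr c, ‖F s‖ ≤ B * (K * Real.log (|s.im| + 4)) ^ R) →
      LSeriesSummable a σ₀ → (∀ s : ℂ, 1 < s.re → LSeries a s = F s) →
      1 ≤ x → 1 < σ₀ → 0 ≤ c' → c' < c → 0 < T → 1 / 2 ≤ σ₁ → σ₁ ≤ σ₀ →
      1 - c' / Real.log (T + 4) ≤ σ₁ →
      ‖∑ n ∈ Finset.Ioc 0 ⌊x⌋₊, a n * ((x : ℂ) - n)‖ ≤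
        1 / (2 * Real.pi) * (2 * (x ^ (1 + σ₀) * (∑' n : ℕ, ‖LSeries.term a σ₀ n‖) / T) +
          4 * Real.pi * (x ^ (1 + σ₁) * (B * (K * Real.log (T + 4)) ^ R)) +
          2 * ((σ₀ - σ₁) * (x ^ (1 + σ₀) * (B * (K * Real.log (T + 4)) ^ R) / T ^ 2))) := by
  intro c K R B a F x σ₀ σ₁ T c' hK hR hB hFd hFb hsum hLF hx hσ₀ hc' hc'c hT hσ₁ hσ₁₀ hσ₁c
  have hx0 : 0 < x := by linarith
  have hre : ∀ t : ℝ, 1 < ((σ₀ : ℂ) + t * I).re := fun t ↦ by simp [hσ₀]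
  -- Perron of order one and the integrand on the line
  have hint : Integrable fun t : ℝ ↦ Phi F x (σ₀ + t * I) := by
    refine (integrable_cpow_mul_LSeries_mul_kernel a hx0 (by linarith) hsum).congr
      (Eventually.of_forall fun t ↦ ?_)
    simp only [Phi]
    rw [hLF _ (hre t)]
  have hA : ∑ n ∈ Finset.Ioc 0 ⌊x⌋₊, a n * ((x : ℂ) - n) =
      (1 / (2 * π) : ℂ) * ∫ t : ℝ, Phi F x (σ₀ + t * I) := by
    rw [RieszMean.sum_mul_sub_eq_integral_LSeries a hx0 (by linarith) hsum]
    congr 1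
    refine integral_congr_ae (Eventually.of_forall fun t ↦ ?_)
    simp only [Phi, kernel]
    rw [hLF _ (hre t)]
  -- Cauchy and the five bounds
  have hsplit := apHol_integral_line_eq hFd hx0 hc' hc'c hT (by linarith) hσ₁₀ hσ₁c hint
  obtain ⟨b2, b1⟩ := apHol_norm_integral_tails_le hx0 hσ₀ hsum hLF hT
  have b3 := apHol_norm_integral_left_le hK hR hB hFb hx hc' hc'c hT hσ₁ hσ₁c
  have b4 := apHol_norm_integral_horizontal_le hK hR hB hFb hx hc' hc'c hT hσ₁₀ hσ₁c
    (T' := -T) (by rw [abs_neg, abs_of_pos hT])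
  have b5 := apHol_norm_integral_horizontal_le hK hR hB hFb hx hc' hc'c hT hσ₁₀ hσ₁c
    (T' := T) (abs_of_pos hT)
  simp only [ofReal_neg, neg_mul] at b4 hsplit
  have hI : ∀ z : ℂ, ‖I * z‖ = ‖z‖ := fun z ↦ by rw [norm_mul, norm_I, one_mul]
  have hline : ‖∫ t : ℝ, Phi F x (σ₀ + t * I)‖ ≤
      2 * (x ^ (1 + σ₀) * (∑' n : ℕ, ‖LSeries.term a σ₀ n‖) / T) +
        4 * π * (x ^ (1 + σ₁) * (B * (K * Real.log (T + 4)) ^ R)) +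
        2 * ((σ₀ - σ₁) * (x ^ (1 + σ₀) * (B * (K * Real.log (T + 4)) ^ R) / T ^ 2)) := by
    rw [hsplit]
    refine (norm_add_add_add_sub_le _ _ _ _ _).trans ?_
    rw [hI, hI]
    linarith [b1, b2, b3, b4, b5]
  -- conclusion
  rw [hA, norm_mul]
  have h2π : ‖(1 / (2 * π) : ℂ)‖ = 1 / (2 * π) := by
    rw [show (1 / (2 * π) : ℂ) = ((1 / (2 * π) : ℝ) : ℂ) by push_cast; ring, Complex.norm_real,
      Real.norm_eq_abs, abs_of_pos (by positivity)]
  rw [h2π]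
  exact mul_le_mul_of_nonneg_left hline (by positivity)

end Summit.Parity.BatemanHorn.Cruxes.SystemZeroRepulsion.NearFar

end
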